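import Summits.CriticalPhenomena.PercolationContinuityZ3.Theorems.FK.InfiniteVolumeMonotone
import Summits.CriticalPhenomena.PercolationContinuityZ3.Theorems.FK.BoxLimitComparison
import Summits.CriticalPhenomena.PercolationContinuityZ3.Theorems.FK.CriticalPointBounds
import Summits.CriticalPhenomena.PercolationContinuityZ3.Theorems.FK.ContinuityTargets
import Literature.Probability.LatticeModels.RandomClusterContinuity
import HarnessLib

/-!
# FK-continuity cell, FO-10a: Grimmett 2006, Prop. (4.28)(b)(c) and Thm. (5.16)(b) — one-sided continuity in `p`
# of the box limits `φ¹_{p,q}` (right) and `φ⁰_{p,q}` (left) on increasing local events, and of `θ¹(·,q)` (right)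

Registered R74 (cell INBOX l.5526, 2026-08-23); registry row FO-10a-g335s; label SEMI-A (coordinator fk-4 g152).
Cell `fk-continuity` (bschramm), row FO-10a (comparison layer over FO-06: `BoxLimitComparison.lean` = Prop. (4.28)(a));
support file for the FK-continuity transplant (`--supports stmt-CriticalPhenomena-4575`); builds on p205010 (kernel
theorem, internal audit signed; external expert review pending). Pure proofs; no definitions, no named facts, no sorries.

Grimmett 2006, Prop. (4.28)(b)(c) [PDF p. 80]: `φ¹_{p,q}(A)` is upper semicontinuous, hence (being non-decreasing,
(4.28)(a)) RIGHT-continuous in `p`, and `φ⁰_{p,q}(A)` is lower semicontinuous, hence LEFT-continuous in `p`, for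
every increasing cylinder event `A` — because `φ¹_{p,q}(A) = inf_n φ¹_{Λ_n,p,q}(A)` and
`φ⁰_{p,q}(A) = sup_n φ⁰_{Λ_n,p,q}(A)` are an infimum / supremum of finite-volume probabilities, which are continuous
in `p` (the Literature's `continuousOn_rcMeasure_real`). Thm. (5.16)(b) [PDF p. 101]: `θ¹(·,q)` is right-continuous on
`[0,1)` — here immediate from the tree's DEFINITION `θ¹(p,q) = inf_n φ¹_{Λ_{n+1},p,q}(0 ↔ ∂Λ_{n+1})`. Consequence for the
cell's wired target: `T_W(q) ⟺ θ¹(p,q) → 0 as p ↓ p_c(q)` (`d ≥ 2`), the kernel form of FO-01 `ContinuityTargets.lean` :68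
("`θ¹` is right-continuous in `p`, so this is continuity of `p ↦ θ¹(p,q)` at `p_c(q)`").

* `continuousWithinAt_Icc_right_of_monotoneOn`, `continuousWithinAt_Icc_left_of_monotoneOn` — real-variable lemmas:
  monotone + upper (lower) semicontinuous within `[a,b]` ⇒ right- (left-) continuous;
* `continuousOn_rcBoxLaw_real` — `p ↦ φ^b_{Λ_n,p,q}(A)` is continuous on `[0,1]` (`q > 0`);
* `eventually_rcLimit_true_real_lt` / `continuousWithinAt_Icc_rcLimit_true_real` — (4.28)(b) for increasing local `A`;
* `eventually_lt_rcLimit_false_real` / `continuousWithinAt_Icc_rcLimit_false_real` — (4.28)(c);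
* `eventually_thetaWired_lt` / `continuousWithinAt_Icc_thetaWired` — Thm. (5.16)(b); `tendsto_thetaWired_nhdsGT`;
  `fkContinuityWired_iff_tendsto_nhdsGT_zero` — `T_W(q) ⟺ Tendsto θ¹(·,q) (𝓝[>] p_c(q)) (𝓝 0)` (`d ≥ 2`, `q ≥ 1`).

## References

* G. Grimmett, *The Random-Cluster Model*, Springer 2006 (`book:grimmett2006-random-cluster-model`): Prop. (4.28)
  and its proof [PDF pp. 79–80]; §5.1 (5.1)–(5.3), Prop. (5.11); Thm. (5.16)(b) and its proof [PDF pp. 101–102]. [Grimmett2006]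
-/

noncomputable section

open MeasureTheory Set Filter
open scoped Topology ENNReal

namespace Summit.CriticalPhenomena.PercolationContinuityZ3.Theorems.FK

open Literature.Probability.Percolation Literature.Probability.LatticeModels
open Literature.Barriers.CriticalPhenomena

/-! ### Two real-variable lemmas: monotone + semicontinuous ⇒ one-sided continuous -/

section Real

/-- A function non-decreasing on `[a,b]` and upper semicontinuous within `[a,b]` at `x ∈ [a,b]` is continuous
from the right at `x` (within `[x,b]`). [folklore] -/
theorem continuousWithinAt_Icc_right_of_monotoneOn {f : ℝ → ℝ} {a b x : ℝ} (hf : MonotoneOn f (Set.Icc a b))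
    (hx : x ∈ Set.Icc a b) (husc : ∀ y, f x < y → ∀ᶠ t in 𝓝[Set.Icc a b] x, f t < y) :
    ContinuousWithinAt f (Set.Icc x b) x := by
  rw [ContinuousWithinAt, tendsto_order]
  refine ⟨fun y hy => ?_, fun y hy => ?_⟩
  · filter_upwards [self_mem_nhdsWithin] with t ht
    exact hy.trans_le (hf hx ⟨hx.1.trans ht.1, ht.2⟩ ht.1)
  · exact (husc y hy).filter_mono (nhdsWithin_mono x (Set.Icc_subset_Icc_left hx.1))

/-- A function non-decreasing on `[a,b]` and lower semicontinuous within `[a,b]` at `x ∈ [a,b]` is continuous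
from the left at `x` (within `[a,x]`). [folklore] -/
theorem continuousWithinAt_Icc_left_of_monotoneOn {f : ℝ → ℝ} {a b x : ℝ} (hf : MonotoneOn f (Set.Icc a b))
    (hx : x ∈ Set.Icc a b) (hlsc : ∀ y, y < f x → ∀ᶠ t in 𝓝[Set.Icc a b] x, y < f t) :
    ContinuousWithinAt f (Set.Icc a x) x := by
  rw [ContinuousWithinAt, tendsto_order]
  refine ⟨fun y hy => ?_, fun y hy => ?_⟩
  · exact (hlsc y hy).filter_mono (nhdsWithin_mono x (Set.Icc_subset_Icc_right hx.2))
  · filter_upwards [self_mem_nhdsWithin] with t ht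
    exact (hf ⟨ht.1, ht.2.trans hx.2⟩ hx ht.2).trans_lt hy

end Real

/-! ### The box laws are continuous in `p` -/

section BoxLaw

variable {d : ℕ}

/-- **`p ↦ φ^b_{Λ_n,p,q}(A)` is continuous on `[0,1]`** (`q > 0`; a quotient of polynomials in `p`, the Literature's
`continuousOn_rcMeasure_real`). [cite: Grimmett2006, proof of Prop. (4.28)(b) ("each φ^1_{Λ_n,p,q}(X) is a continuous function of p")] -/
theorem continuousOn_rcBoxLaw_real (b : Bool) {q : ℝ} (hq : 0 < q) (n : ℕ) {A : Set (BondConfig (Site d))}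
    (hA : MeasurableSet A) : ContinuousOn (fun p : ℝ => (rcBoxLaw d b p q n).real A) (Set.Icc 0 1) := by
  simp_rw [rcBoxLaw_real_apply b _ q n hA]
  exact continuousOn_rcMeasure_real _ hq _ _

end BoxLaw

/-! ### Prop. (4.28)(b): `φ¹_{p,q}(A)` is upper semicontinuous and right-continuous in `p` -/

section Wired

variable {d : ℕ} {q : ℝ} {A : Set (BondConfig (Site d))} {F : Finset (Sym2 (Site d))}

/-- **Upper semicontinuity of `p ↦ φ¹_{p,q}(A)` within `[0,1]`** for an increasing local event `A` (`q ≥ 1`, `d ≥ 1`):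
if `φ¹_{p₀,q}(A) < y` then `φ¹_{p,q}(A) < y` for `p ∈ [0,1]` near `p₀` — since `φ¹_{p,q}(A) ≤ φ¹_{Λ_n,p,q}(A) → φ¹_{p₀,q}(A)`.
[cite: Grimmett2006, Prop. (4.28)(b)] -/
theorem eventually_rcLimit_true_real_lt (hd : 0 < d) (hq : 1 ≤ q) (hA : DeterminedBy A ↑F) (hAu : IsUpperSet A)
    {p₀ : ℝ} (hp₀ : p₀ ∈ Set.Icc (0 : ℝ) 1) {y : ℝ} (hy : (rcLimit d true p₀ q).real A < y) :
    ∀ᶠ p in 𝓝[Set.Icc 0 1] p₀, (rcLimit d true p q).real A < y := by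
  have hq0 : 0 < q := one_pos.trans_le hq
  have hAl : IsLocalEvent A := ⟨F, hA⟩
  -- a box containing the support of `A`, large enough that its wired probability is already `< y`
  obtain ⟨n₀, hn₀⟩ := DCT16.exists_subset_box (F.biUnion fun e => e.toFinset)
  have hF : ∀ n, n₀ ≤ n → ∀ e ∈ F, ∀ z ∈ e, z ∈ box d n := fun n hn e he z hz =>
    box_mono d hn (hn₀ (Finset.mem_biUnion.2 ⟨e, he, Sym2.mem_toFinset.2 hz⟩))
  have hlim := (isBoxLimit_rcLimit true hp₀ hq).tendsto_real hAl
  obtain ⟨n, hn, hny⟩ : ∃ n, n₀ ≤ n ∧ (rcBoxLaw d true p₀ q n).real A < y := by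
    have h := (tendsto_order.1 hlim).2 y hy
    obtain ⟨n, hn⟩ := (h.and (eventually_ge_atTop n₀)).exists
    exact ⟨n, hn.2, hn.1⟩
  -- continuity of the box law at `p₀`
  have hcont : ContinuousWithinAt (fun p : ℝ => (rcBoxLaw d true p q n).real A) (Set.Icc 0 1) p₀ :=
    continuousOn_rcBoxLaw_real true hq0 n (measurableSet_of_isLocalEvent_holds hAl) p₀ hp₀
  have hev : ∀ᶠ p in 𝓝[Set.Icc 0 1] p₀, (rcBoxLaw d true p q n).real A < y := (tendsto_order.1 hcont).2 y hny
  filter_upwards [hev, self_mem_nhdsWithin] with p hp hpI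
  exact (rcLimit_real_le_rcBoxLaw hd hpI hq hA hAu (hF n hn)).trans_lt hp

/-- **Prop. (4.28)(b): `p ↦ φ¹_{p,q}(A)` is right-continuous on `[0,1]`** for every increasing local event `A`
(`q ≥ 1`): monotone by (4.28)(a) and upper semicontinuous. [cite: Grimmett2006, Prop. (4.28)(b)] -/
theorem continuousWithinAt_Icc_rcLimit_true_real (hd : 0 < d) (hq : 1 ≤ q) (hA : DeterminedBy A ↑F)
    (hAu : IsUpperSet A) {p₀ : ℝ} (hp₀ : p₀ ∈ Set.Icc (0 : ℝ) 1) :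
    ContinuousWithinAt (fun p : ℝ => (rcLimit d true p q).real A) (Set.Icc p₀ 1) p₀ := by
  refine continuousWithinAt_Icc_right_of_monotoneOn (a := 0) (b := 1) ?_ hp₀ fun y hy =>
    eventually_rcLimit_true_real_lt hd hq hA hAu hp₀ hy
  intro p₁ hp₁ p₂ hp₂ h12
  exact rcLimit_real_mono_left true (exists_isBoxLimit true hp₁ hq) (exists_isBoxLimit true hp₂ hq) hp₁ hp₂ h12 hq hAu hA

/-- The same as a one-sided limit: `φ¹_{p,q}(A) → φ¹_{p₀,q}(A)` as `p ↓ p₀`, `p₀ ∈ [0,1)`. [cite: Grimmett2006, Prop. (4.28)(b)] -/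
theorem tendsto_rcLimit_true_real_nhdsGT (hd : 0 < d) (hq : 1 ≤ q) (hA : DeterminedBy A ↑F) (hAu : IsUpperSet A)
    {p₀ : ℝ} (hp₀ : p₀ ∈ Set.Ico (0 : ℝ) 1) :
    Tendsto (fun p : ℝ => (rcLimit d true p q).real A) (𝓝[>] p₀) (𝓝 ((rcLimit d true p₀ q).real A)) := by
  have h := continuousWithinAt_Icc_rcLimit_true_real hd hq hA hAu ⟨hp₀.1, hp₀.2.le⟩
  rw [ContinuousWithinAt] at h
  rw [← nhdsWithin_Ioc_eq_nhdsGT hp₀.2]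
  exact h.mono_left (nhdsWithin_mono _ Set.Ioc_subset_Icc_self)

end Wired

/-! ### Prop. (4.28)(c): `φ⁰_{p,q}(A)` is lower semicontinuous and left-continuous in `p` -/

section Free

variable {d : ℕ} {q : ℝ} {A : Set (BondConfig (Site d))} {F : Finset (Sym2 (Site d))}

/-- **Lower semicontinuity of `p ↦ φ⁰_{p,q}(A)` within `[0,1]`** for an increasing local event `A` (`q ≥ 1`):
if `y < φ⁰_{p₀,q}(A)` then `y < φ⁰_{p,q}(A)` for `p ∈ [0,1]` near `p₀` — since `φ⁰_{Λ_n,p,q}(A) ≤ φ⁰_{p,q}(A)` and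
`φ⁰_{Λ_n,p₀,q}(A) → φ⁰_{p₀,q}(A)`. [cite: Grimmett2006, Prop. (4.28)(c)] -/
theorem eventually_lt_rcLimit_false_real (hq : 1 ≤ q) (hA : DeterminedBy A ↑F) (hAu : IsUpperSet A)
    {p₀ : ℝ} (hp₀ : p₀ ∈ Set.Icc (0 : ℝ) 1) {y : ℝ} (hy : y < (rcLimit d false p₀ q).real A) :
    ∀ᶠ p in 𝓝[Set.Icc 0 1] p₀, y < (rcLimit d false p q).real A := by
  have hq0 : 0 < q := one_pos.trans_le hq
  have hAl : IsLocalEvent A := ⟨F, hA⟩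
  have hlim := (isBoxLimit_rcLimit false hp₀ hq).tendsto_real hAl
  obtain ⟨n, hny⟩ : ∃ n, y < (rcBoxLaw d false p₀ q n).real A := ((tendsto_order.1 hlim).1 y hy).exists
  have hcont : ContinuousWithinAt (fun p : ℝ => (rcBoxLaw d false p q n).real A) (Set.Icc 0 1) p₀ :=
    continuousOn_rcBoxLaw_real false hq0 n (measurableSet_of_isLocalEvent_holds hAl) p₀ hp₀
  have hev : ∀ᶠ p in 𝓝[Set.Icc 0 1] p₀, y < (rcBoxLaw d false p q n).real A := (tendsto_order.1 hcont).1 y hny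
  filter_upwards [hev, self_mem_nhdsWithin] with p hp hpI
  exact hp.trans_le (rcBoxLaw_real_le_rcLimit hpI hq hAl hAu n)

/-- **Prop. (4.28)(c): `p ↦ φ⁰_{p,q}(A)` is left-continuous on `[0,1]`** for every increasing local event `A`
(`q ≥ 1`): monotone by (4.28)(a) and lower semicontinuous. [cite: Grimmett2006, Prop. (4.28)(c)] -/
theorem continuousWithinAt_Icc_rcLimit_false_real (hq : 1 ≤ q) (hA : DeterminedBy A ↑F) (hAu : IsUpperSet A)
    {p₀ : ℝ} (hp₀ : p₀ ∈ Set.Icc (0 : ℝ) 1) :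
    ContinuousWithinAt (fun p : ℝ => (rcLimit d false p q).real A) (Set.Icc 0 p₀) p₀ := by
  refine continuousWithinAt_Icc_left_of_monotoneOn (a := 0) (b := 1) ?_ hp₀ fun y hy =>
    eventually_lt_rcLimit_false_real hq hA hAu hp₀ hy
  intro p₁ hp₁ p₂ hp₂ h12
  exact rcLimit_real_mono_left false (exists_isBoxLimit false hp₁ hq) (exists_isBoxLimit false hp₂ hq) hp₁ hp₂ h12 hq
    hAu hA

/-- The same as a one-sided limit: `φ⁰_{p,q}(A) → φ⁰_{p₀,q}(A)` as `p ↑ p₀`, `p₀ ∈ (0,1]`. [cite: Grimmett2006, Prop. (4.28)(c)] -/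
theorem tendsto_rcLimit_false_real_nhdsLT (hq : 1 ≤ q) (hA : DeterminedBy A ↑F) (hAu : IsUpperSet A)
    {p₀ : ℝ} (hp₀ : p₀ ∈ Set.Ioc (0 : ℝ) 1) :
    Tendsto (fun p : ℝ => (rcLimit d false p q).real A) (𝓝[<] p₀) (𝓝 ((rcLimit d false p₀ q).real A)) := by
  have h := continuousWithinAt_Icc_rcLimit_false_real hq hA hAu ⟨hp₀.1.le, hp₀.2⟩
  rw [ContinuousWithinAt] at h
  rw [← nhdsWithin_Ico_eq_nhdsLT hp₀.1]
  exact h.mono_left (nhdsWithin_mono _ Set.Ico_subset_Icc_self)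

end Free

/-! ### Thm. (5.16)(b): `θ¹(·,q)` is upper semicontinuous and right-continuous on `[0,1]` -/

section Theta

variable {d : ℕ} {q : ℝ}

/-- **Upper semicontinuity of `θ¹(·,q)` within `[0,1]`** (`q > 0`): `θ¹(p,q) = inf_n φ¹_{Λ_{n+1},p,q}(0 ↔ ∂Λ_{n+1})` is an
infimum of functions continuous on `[0,1]`. [cite: Grimmett2006, Thm. (5.16)(b) (proof via Prop. (4.28)(b)) and Prop. (5.11)] -/
theorem eventually_thetaWired_lt (hq : 0 < q) {p₀ : ℝ} (hp₀ : p₀ ∈ Set.Icc (0 : ℝ) 1) {y : ℝ}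
    (hy : thetaWired d p₀ q < y) : ∀ᶠ p in 𝓝[Set.Icc 0 1] p₀, thetaWired d p q < y := by
  obtain ⟨n, hn⟩ : ∃ n : ℕ, thetaWiredBox d p₀ q (n + 1) < y := exists_lt_of_ciInf_lt hy
  have hcont : ContinuousWithinAt (fun p : ℝ => thetaWiredBox d p q (n + 1)) (Set.Icc 0 1) p₀ :=
    continuousWithinAt_rcMeasure_real (boxGraph d (n + 1)) hq (boxBoundary d (n + 1)) _ hp₀
  have hev : ∀ᶠ p in 𝓝[Set.Icc 0 1] p₀, thetaWiredBox d p q (n + 1) < y := (tendsto_order.1 hcont).2 y hn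
  filter_upwards [hev] with p hp
  exact (ciInf_le (bddBelow_range_thetaWiredBox d p q) n).trans_lt hp

/-- **Thm. (5.16)(b): `θ¹(·,q)` is right-continuous on `[0,1]`** (`q ≥ 1`): non-decreasing in `p` (Prop. (4.28)(a))
and upper semicontinuous. [cite: Grimmett2006, Thm. (5.16)(b)] -/
theorem continuousWithinAt_Icc_thetaWired (hq : 1 ≤ q) {p₀ : ℝ} (hp₀ : p₀ ∈ Set.Icc (0 : ℝ) 1) :
    ContinuousWithinAt (fun p : ℝ => thetaWired d p q) (Set.Icc p₀ 1) p₀ :=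
  continuousWithinAt_Icc_right_of_monotoneOn (a := 0) (b := 1)
    (fun _ hp₁ _ hp₂ h12 => thetaWired_mono_left d hp₁ hp₂ h12 hq) hp₀
    fun _ hy => eventually_thetaWired_lt (one_pos.trans_le hq) hp₀ hy

/-- `θ¹(p,q) → θ¹(p₀,q)` as `p ↓ p₀`, for `p₀ ∈ [0,1)` (`q ≥ 1`). [cite: Grimmett2006, Thm. (5.16)(b)] -/
theorem tendsto_thetaWired_nhdsGT (hq : 1 ≤ q) {p₀ : ℝ} (hp₀ : p₀ ∈ Set.Ico (0 : ℝ) 1) :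
    Tendsto (fun p : ℝ => thetaWired d p q) (𝓝[>] p₀) (𝓝 (thetaWired d p₀ q)) := by
  have h := continuousWithinAt_Icc_thetaWired (d := d) hq ⟨hp₀.1, hp₀.2.le⟩
  rw [ContinuousWithinAt] at h
  rw [← nhdsWithin_Ioc_eq_nhdsGT hp₀.2]
  exact h.mono_left (nhdsWithin_mono _ Set.Ioc_subset_Icc_self)

/-- **`T_W(q)` is continuity of `θ¹(·,q)` at `p_c(q)` from the right**: for `d ≥ 2`, `q ≥ 1`,
`FKContinuityWired d q ↔ θ¹(p,q) → 0` as `p ↓ p_c(q)` — the kernel form of the remark "`θ¹` is right-continuous in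
`p`, so `T_W` is continuity of `p ↦ θ¹(p,q)` at `p_c(q)`" (`ContinuityTargets.lean`; `p_c(q) < 1` by FO-01b's
`rcCriticalProb_lt_one`). [cite: Grimmett2006, Thm. (5.16)(b) with §5.1 (5.1)–(5.3)] -/
theorem fkContinuityWired_iff_tendsto_nhdsGT_zero (hd : 2 ≤ d) (hq : 1 ≤ q) :
    FKContinuityWired d q ↔ Tendsto (fun p : ℝ => thetaWired d p q) (𝓝[>] (rcCriticalProb d q)) (𝓝 0) := by
  have hpc : rcCriticalProb d q ∈ Set.Ico (0 : ℝ) 1 := ⟨(rcCriticalProb_mem_Icc d q).1, rcCriticalProb_lt_one hd hq⟩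
  have h := tendsto_thetaWired_nhdsGT (d := d) hq hpc
  refine ⟨fun hW => by rwa [show thetaWired d (rcCriticalProb d q) q = 0 from hW] at h, fun h0 => ?_⟩
  haveI : (𝓝[>] rcCriticalProb d q).NeBot := inferInstance
  exact tendsto_nhds_unique h h0

/-- Equivalently, in `ε`-form: `T_W(q)` iff for every `ε > 0` some `p ∈ (p_c(q), 1]` has `θ¹(p,q) < ε` (`d ≥ 2`, `q ≥ 1`).
[cite: Grimmett2006, Thm. (5.16)(b) with §5.1 (5.1)–(5.3)] -/
theorem fkContinuityWired_iff_forall_exists_thetaWired_lt (hd : 2 ≤ d) (hq : 1 ≤ q) :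
    FKContinuityWired d q ↔ ∀ ε > 0, ∃ p, rcCriticalProb d q < p ∧ p ≤ 1 ∧ thetaWired d p q < ε := by
  have hpc1 : rcCriticalProb d q < 1 := rcCriticalProb_lt_one hd hq
  have hpcI := rcCriticalProb_mem_Icc d q
  constructor
  · intro hW ε hε
    have h := (tendsto_order.1 ((fkContinuityWired_iff_tendsto_nhdsGT_zero hd hq).1 hW)).2 ε hε
    obtain ⟨p, hp, hpI⟩ := (h.and (Ioc_mem_nhdsGT hpc1)).exists
    exact ⟨p, hpI.1, hpI.2, hp⟩
  · intro h
    refine le_antisymm ?_ (thetaWired_nonneg d _ q)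
    refine le_of_forall_pos_lt_add fun ε hε => ?_
    obtain ⟨p, hpc, hp1, hpε⟩ := h ε hε
    rw [zero_add]
    exact (thetaWired_mono_left d hpcI ⟨hpcI.1.trans hpc.le, hp1⟩ hpc.le hq).trans_lt hpε

end Theta

/-! ### The edge densities: `h¹(·,q)` is right-continuous and `h⁰(·,q)` left-continuous (Grimmett's use of (4.28) in Thm. (4.63)) -/

section EdgeDensity

variable {d : ℕ} {q : ℝ}

/-- The coordinate event `{e ∈ ω}` is increasing and determined by `{e}`. [folklore] -/
theorem isUpperSet_setOf_mem_and_determinedBy (e : Sym2 (Site d)) :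
    IsUpperSet {ω : BondConfig (Site d) | e ∈ ω} ∧ DeterminedBy {ω : BondConfig (Site d) | e ∈ ω} ↑({e} : Finset _) := by
  refine ⟨fun ω ω' hle hω => hle hω, (determinedBy_iff _ _).2 fun ω ω' h => ?_⟩
  have := Set.ext_iff.1 h e
  simp only [Finset.coe_singleton, Set.mem_inter_iff, Set.mem_singleton_iff, and_true] at this
  exact this

/-- **`p ↦ h¹(p,q)(e)` is right-continuous on `[0,1]`** (`q ≥ 1`, `d ≥ 1`): the wired edge density is the
one-edge marginal of `φ¹_{p,q}` (FO-06b's `IsBoxLimit.real_setOf_mem_eq_wiredEdgeDensity`), an increasing cylinder.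
[cite: Grimmett2006, Prop. (4.28)(b), used in the proof of Thm. (4.63) ("h¹(·,q) is right-continuous")] -/
theorem continuousWithinAt_Icc_wiredEdgeDensity (hd : 0 < d) (hq : 1 ≤ q) (e : Sym2 (Site d)) {p₀ : ℝ}
    (hp₀ : p₀ ∈ Set.Icc (0 : ℝ) 1) :
    ContinuousWithinAt (fun p : ℝ => wiredEdgeDensity d p q e) (Set.Icc p₀ 1) p₀ := by
  obtain ⟨hAu, hA⟩ := isUpperSet_setOf_mem_and_determinedBy e
  refine (continuousWithinAt_Icc_rcLimit_true_real hd hq hA hAu hp₀).congr (fun p hp => ?_) ?_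
  · exact ((isBoxLimit_rcLimit true ⟨hp₀.1.trans hp.1, hp.2⟩ hq).real_setOf_mem_eq_wiredEdgeDensity hd
      ⟨hp₀.1.trans hp.1, hp.2⟩ hq e).symm
  · exact ((isBoxLimit_rcLimit true hp₀ hq).real_setOf_mem_eq_wiredEdgeDensity hd hp₀ hq e).symm

/-- **`p ↦ h⁰(p,q)(e)` is left-continuous on `[0,1]`** (`q ≥ 1`): the free edge density is the one-edge marginal of
`φ⁰_{p,q}`. [cite: Grimmett2006, Prop. (4.28)(c), used in the proof of Thm. (4.63) ("h⁰(·,q) is left-continuous")] -/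
theorem continuousWithinAt_Icc_freeEdgeDensity (hq : 1 ≤ q) (e : Sym2 (Site d)) {p₀ : ℝ}
    (hp₀ : p₀ ∈ Set.Icc (0 : ℝ) 1) :
    ContinuousWithinAt (fun p : ℝ => freeEdgeDensity d p q e) (Set.Icc 0 p₀) p₀ := by
  obtain ⟨hAu, hA⟩ := isUpperSet_setOf_mem_and_determinedBy e
  refine (continuousWithinAt_Icc_rcLimit_false_real hq hA hAu hp₀).congr (fun p hp => ?_) ?_
  · exact ((isBoxLimit_rcLimit false ⟨hp.1, hp.2.trans hp₀.2⟩ hq).real_setOf_mem_eq_freeEdgeDensity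
      ⟨hp.1, hp.2.trans hp₀.2⟩ hq e).symm
  · exact ((isBoxLimit_rcLimit false hp₀ hq).real_setOf_mem_eq_freeEdgeDensity hp₀ hq e).symm

end EdgeDensity

end Summit.CriticalPhenomena.PercolationContinuityZ3.Theorems.FK

end
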